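import Summits.QuantumFields.BalabanUV.T4Continuum.Support.VariationalColourTaxiTowerProjGRegular

/-!
# T⁴ programme, spine node NE2 (U1a), lane P2 — «V-COL-TAXI-END» part 8: THE RATE HALF FOR BAŁABAN's COVARIANT PROJECTED GAUGE FUNCTIONAL IN THE REGULAR CLASS —
# the vector END WITH RATE (part 4 `towerLimitRate_effV_taxiTower_min_of_class`, p227348) for `G k := projG (Rlev k) (ker Q_{taxi,k})` at Bałaban's taxi data,
# with the G-side (matrix form, `Gtr`, (GF1′), (Går) ⇐ (GF3) SUPPLIED by part 7, V-REG by leaf-03-g6) INHABITED: `TowerLimitRate … θ` ⇐ (SLICE-min)_k + (ONE-min)_k +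
# a regular presentation of the tower + numeric smallness (model level, `E = ℂ`)

NE2 formalisation swarm `b2b-balaban-t4-ne2-formalise-*`, leaf prover 04 GEN 6 (`prover-b2b-balaban-t4-ne2-formalise-leaf-04-g6-0`); journal CLAIMS.log «THE CAPSTONE's
`hGdiv` DISCHARGED IN THE REGULAR CLASS», RATE twin.  On top of part 7 `VariationalColourTaxiTowerProjGRegular.hGdiv_projG_nestLv_regular` (this seat: (GF3)_k from a regular
presentation), part 6 `VariationalColourTaxiTowerProjG.{hGF_projG_taxi, hGar_projG_nestLv, hPc_projG_nestLv, hUBc_projG_nestLv}` (gen 5), part 4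
`VariationalColourTaxiTowerEndMin.{taxiClassPackage, towerLimitRate_effV_taxiTower_min_of_class}` (gen 5), leaf-03-g6's `VariationalVectorRegularityCovariant.{GmProj,
GmProj_posSemidef, projG_eq_qform, hREG_projG}` (p228016), leaf-09-g7's `VariationalVectorGaugeSliceTower.Gtr_pullback` and `CovariantBlockReversePoincare.revPC` — BY NAME.

THE STATEMENT.  **`towerLimitRate_effV_taxiTower_projG_regular_of_class`**: hypotheses = part 4's one-step bond data (unitary, plaquette class `(L^{k+1})²b_k ≤ c`,
coherent) with its polynomial smallness `hsm1–hsm4`; part 7's DISPLAYED regular presentation of `Rlev k` (`‖Rlev k − 1‖ ≤ a_k`, `‖Rlev k(x,μ) − Rlev k(x−e_μ,μ)‖ ≤ ℓ_k`,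
`L^k·a_k ≤ α`, `(L^k)²·ℓ_k ≤ λ`) and its two numeric lines; the rate `L⁻¹ ≤ θ < 1`; and the TWO displayed analytic leaves (SLICE-min)_k (costs `σ, σ′ ≤ c·θ^k`) and
(ONE-min)_k (`ε₁, δ′ ≤ c·θ^k`, V-REG size `rhoV`) for `G k := projG (Rlev k) (ker Q_{taxi,k})`, `G′ k := G (k+1) ∘ sites`.  Conclusion: part 4's `TowerLimitRate` for
`effV (L^k) M (Rlev k) (GmProj …) (QmL (nestLv k)) aa` at rate `θ` with the constants `Λ⋆ = 4·lamV d ((d−1)c) d 0`, `κ⋆ = 2(1 + C_D)`, `κ⋆′ = 2(C_D′ + 64dc)`,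
`C_P⋆ = max(40κ⋆, 64 + 40κ⋆′)`, `C_R⋆ = 8Λ⋆ + 2dc(κ⋆ + κ⋆′) + (8R⋆² + 5d²c²)C_P⋆`, `R⋆ = 4d·36^d(1 + (d−1)c)²`, `C_D = 36C_f + 8`, `C_D′ = 24C_f + 4`, `C_f = d(d+1)Cst(d,1)`,
all written out.  §1 **`projG_sockets_nestLv`** factors part 6's inline bookkeeping into a lemma: from the class package's per-level facts and (GF3)_k with uniform
`C_D, C_D′`, the four sockets V-UB ∕ (Går) ∕ V-P ∕ V-REG of `projG` on the tower's carriers hold with the uniform constants above (V-REG by leaf-03-g6's `hREG_projG`);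
§2 inhabits part 4's G-side with them, (GF3)_k := part 7.
NOT HERE: (SLICE-min) ∕ (ONE-min) with background (leaf-01 ∕ leaf-10 lineages).  LOCATED STATUS OF THE DISPLAYED LEAVES (memo `t4/T4-EST-NE2-P2-VGF.md`
(V2)∕(V2′)∕(V5), leaf-01-g7, kit numerics d = 2, U(1)): (SLICE) as typed is DEAD (first order in c); the (SLICE-min) constant `σ′` is measured ≈ 10⁻³c⁴ (flat carriers)
∕ ≈ 0.017c² (taxi carriers) and LEVEL-INDEPENDENT — so the geometric decay `σ′_k ≤ c_σ′·θ^k` displayed below is NOT expected in the fixed-class model (summable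
only along an asymptotically free trajectory `c_k → 0`); this RATE END is therefore recorded as the CONDITIONAL SHAPE of the road, while part 7's EXISTENCE END
(monotone route, displaying (ONE-min) only) is the statement whose remaining leaf is measured favourable.

HONEST FRAMING (T4-DAG p. 1).  Rung (B)+1 only — NOT infinite volume, NOT a mass gap, NOT Clay.  NE2 NOT IN PRINT, NOT proved here.  MODEL LEVEL (`E = ℂ`; bond
operators DATA; taxi ∕ straight contours and the straight-taxi slice subspace OURS; SHAPES only; no B0, c5).  The regular presentation is a HYPOTHESIS on the presented
tower (gauge covariance not proved here — leaf-03-g7's «V-GAUGE-COV»); the thresholds are tiny, n-UNIFORM, NOT optimised.  OURS, [folklore]; nothing printed is a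
hypothesis; no `def`, no `def … : Prop`, no `sorry`; axioms standard.  V-END with background NOT proved ((SLICE-min), (ONE-min) displayed); NE2 NOT proved on either road;
NE3 OPEN; spine PROVED 0∕9.  HONEST DEPENDENCY (cell, verbatim): continuum YM on T⁴ ⇐ BetaPertH ∧ nine spine estimates (0/9 proved); BetaPertH ⇐ (D1) ∧ (D4) ∧ CAP+tail;
G-an2-4 gates asym, D1 and NE2/3/4.
-/

noncomputable section

namespace Summit.QuantumFields.BalabanUV.T4Continuum.VariationalColourTaxiTransport

open Finset Filter
open scoped Matrix ComplexOrder BigOperators Topology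
open Literature.MathematicalPhysics.QuantumFieldTheory.Balaban1983to89.B5Prop11Plancherel (Tor fine unitVec Cst)
open Literature.Analysis.Complex (qform)
open Summit.QuantumFields.BalabanUV.T4Continuum.VariationalTransfer (blockSpin)
open Summit.QuantumFields.BalabanUV.T4Continuum.VariationalColourFederbush (norm_le_one_of_mem_unitary)
open Summit.QuantumFields.BalabanUV.T4Continuum.VariationalColourTower (Rtrv)
open Summit.QuantumFields.BalabanUV.T4Continuum.VariationalVectorFederbush (lineT)
open Summit.QuantumFields.BalabanUV.T4Continuum.CovariantAveragingTower (TowerLimitRate)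
open Summit.QuantumFields.BalabanUV.T4Continuum.VectorBlockTrialForm (nsqV nsqV_nonneg QvL roughV kappaV)
open Summit.QuantumFields.BalabanUV.T4Continuum.VariationalVectorForm (ScV SfV qWV lamV lamV_nonneg ScV_nonneg)
open Summit.QuantumFields.BalabanUV.T4Continuum.VariationalVectorEffective (unc effV)
open Summit.QuantumFields.BalabanUV.T4Continuum.VariationalVectorTower (Gtr QmL)
open Summit.QuantumFields.BalabanUV.T4Continuum.VariationalVectorEndOfLeaves (eV ePV)
open Summit.QuantumFields.BalabanUV.T4Continuum.VariationalVectorWeitzenbock (divSq)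
open Summit.QuantumFields.BalabanUV.T4Continuum.VariationalVectorGaugeSlice (avgOp projG projG_nonneg)
open Summit.QuantumFields.BalabanUV.T4Continuum.VariationalVectorGaugeSliceTower (Gtr_pullback)
open Summit.QuantumFields.BalabanUV.T4Continuum.VariationalVectorOneStepPhys (rhoV rhoV_nonneg)
open Summit.QuantumFields.BalabanUV.T4Continuum.VariationalVectorRegularityCovariant (GmProj GmProj_posSemidef projG_eq_qform hREG_projG)
open Summit.QuantumFields.BalabanUV.T4Continuum.CovariantBlockReversePoincare (revPC revPC_nonneg)
open Summit.QuantumFields.BalabanUV.T4Continuum.SliceComplementFlatGap (deltaGap)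

variable {d : ℕ}
variable (L : ℕ) [NeZero L] (M : Fin d → ℕ) [hM : ∀ μ, NeZero (M μ)]
variable {R' : (k : ℕ) → Tor (fine L (fine (L ^ k) M)) → Fin d → (ℂ →L[ℂ] ℂ)}

/-! ## §1 The uniform sockets of Bałaban's projected functional on the tower's carriers, from (GF3) (part 6's bookkeeping as a lemma) -/

/-- **THE UNIFORM SOCKETS OF BAŁABAN's PROJECTED FUNCTIONAL ON THE TOWER's CARRIERS, FROM (GF3)** — part 6's inline bookkeeping as a lemma: given the class package's
per-level facts (plaquette bounds `a_k` of `Rlev k` in the class, the V-UB ∕ V-P smallness lines, (E_k), `Λ_k ≤ Λ⋆`) and (GF3)_k with UNIFORM constants `C_D, C_D′ ≥ 0`,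
the four sockets of the vector ENDs hold with uniform constants: V-UB (`Λ⋆ = 4·lamV d ((d−1)c) d 0`), (Går) (`κ⋆ = 2(1 + C_D)`, `κ⋆′ = 2(C_D′ + 64dc)`), V-P
(`C_P⋆ = max(40κ⋆, 64 + 40κ⋆′)`) and V-REG (`C_R⋆ = 8Λ⋆ + 2dc(κ⋆ + κ⋆′) + (8R⋆² + 5d²c²)C_P⋆`, `R⋆ = 4d·36^d(1 + (d−1)c)²`, leaf-03-g6's `hREG_projG`). [folklore] -/
theorem projG_sockets_nestLv (hd : 1 ≤ d) (hM2 : ∀ μ, 1 < M μ)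
    (hU : ∀ k x μ, R' k x μ ∈ unitary (ℂ →L[ℂ] ℂ)) {b : ℕ → ℝ} {c : ℝ}
    (hb : ∀ k x κ ι, ‖R' k x κ * R' k (x + unitVec (fine L (fine (L ^ k) M)) κ) ι - R' k x ι * R' k (x + unitVec (fine L (fine (L ^ k) M)) ι) κ‖ ≤ b k)
    (hcoh : ∀ k, coarseTv L (fine (L ^ (k + 1)) M) (R' (k + 1)) = Rtrv (L ^ k) L M (R' k))
    {a : ℕ → ℝ} (ha0 : ∀ k, 0 ≤ a k)
    (ha : ∀ k x κ ι, ‖Rlev L M R' k x κ * Rlev L M R' k (x + unitVec (fine (L ^ k) M) κ) ι - Rlev L M R' k x ι * Rlev L M R' k (x + unitVec (fine (L ^ k) M) ι) κ‖ ≤ a k)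
    (hac : ∀ k, (((L ^ k : ℕ)) : ℝ) ^ 2 * a k ≤ c)
    (hκγ : ∀ k, (kappaV d (L ^ k))⁻¹ * ((∑ q ∈ Finset.range k, ((((d - 1 : ℕ) : ℝ) + (d : ℝ) * d) * (((L : ℝ) * ((L ^ q - 1 : ℕ) : ℝ) * ((L - 1 : ℕ) : ℝ)) * b q)))
        + 3 * (((d - 1 : ℕ) : ℝ) * (L ^ k : ℕ) * ((L ^ k - 1 : ℕ) : ℝ) * a k)) ≤ 1 / 2)
    (hsmallP : ∀ k, 2 * (d : ℝ) * ((((L ^ k : ℕ) : ℝ)) * (((d - 1 : ℕ) : ℝ) * ((L ^ k - 1 : ℕ) : ℝ) * a k)) ^ 2 ≤ 1 / 2)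
    (hγs : ∀ k, 64 * (∑ q ∈ Finset.range k, ((((d - 1 : ℕ) : ℝ) + (d : ℝ) * d) * (((L : ℝ) * ((L ^ q - 1 : ℕ) : ℝ) * ((L - 1 : ℕ) : ℝ)) * b q))) ^ 2 ≤ 1)
    (hΛk : ∀ k, lamV d ((L ^ k : ℕ) * (((d - 1 : ℕ) : ℝ) * ((L ^ k - 1 : ℕ) : ℝ) * a k)) (d : ℝ) (((L ^ k : ℕ) : ℝ) ^ 2 * 0)
        / (1 - (kappaV d (L ^ k))⁻¹ * ((∑ q ∈ Finset.range k, ((((d - 1 : ℕ) : ℝ) + (d : ℝ) * d) * (((L : ℝ) * ((L ^ q - 1 : ℕ) : ℝ) * ((L - 1 : ℕ) : ℝ)) * b q)))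
            + 3 * (((d - 1 : ℕ) : ℝ) * (L ^ k : ℕ) * ((L ^ k - 1 : ℕ) : ℝ) * a k))) ^ 2 ≤ (4 * lamV d (((d - 1 : ℕ) : ℝ) * c) (d : ℝ) 0))
    (hsmall4 : 80 * ((d : ℝ) * c) ≤ 1) {CDs CDs' : ℝ} (hCDs0 : 0 ≤ CDs) (hCDs0' : 0 ≤ CDs')
    (hGdiv : ∀ k W, ((((L ^ k : ℕ) : ℝ)) ^ d)⁻¹ * ((((L ^ k : ℕ) : ℝ)) ^ 2 * divSq (fine (L ^ k) M) (Rlev L M R' k) W)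
      ≤ CDs * ScV (L ^ k) M (Rlev L M R' k) (projG (fine (L ^ k) M) (Rlev L M R' k) (LinearMap.ker (avgOp (L ^ k) M (taxiTv (L ^ k) M (Rlev L M R' k))))) W + CDs' * nsqV M (QvL (L ^ k) M (nestLv L M R' k) W)) :
    (∀ k (φ : Tor M → Fin d → ℂ), ∃ W, QvL (L ^ k) M (nestLv L M R' k) W = φ ∧ ScV (L ^ k) M (Rlev L M R' k) (projG (fine (L ^ k) M) (Rlev L M R' k) (LinearMap.ker (avgOp (L ^ k) M (taxiTv (L ^ k) M (Rlev L M R' k))))) W ≤ (4 * lamV d (((d - 1 : ℕ) : ℝ) * c) (d : ℝ) 0) * nsqV M φ) ∧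
    (∀ k W, ((((L ^ k : ℕ) : ℝ)) ^ d)⁻¹ * ((((L ^ k : ℕ) : ℝ)) ^ 2 * roughV (L ^ k) M (Rlev L M R' k) W)
      ≤ (2 * (1 + CDs)) * ScV (L ^ k) M (Rlev L M R' k) (projG (fine (L ^ k) M) (Rlev L M R' k) (LinearMap.ker (avgOp (L ^ k) M (taxiTv (L ^ k) M (Rlev L M R' k))))) W + (2 * (CDs' + (d : ℝ) * c * 64)) * nsqV M (QvL (L ^ k) M (nestLv L M R' k) W)) ∧
    (∀ k W, qWV (L ^ k) M W ≤ (max (40 * (2 * (1 + CDs))) (64 + 40 * (2 * (CDs' + (d : ℝ) * c * 64)))) * (ScV (L ^ k) M (Rlev L M R' k) (projG (fine (L ^ k) M) (Rlev L M R' k) (LinearMap.ker (avgOp (L ^ k) M (taxiTv (L ^ k) M (Rlev L M R' k))))) W + nsqV M (QvL (L ^ k) M (nestLv L M R' k) W))) ∧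
    (∀ k (φ : Tor M → Fin d → ℂ) W, QvL (L ^ k) M (nestLv L M R' k) W = φ →
      (∀ W₂, QvL (L ^ k) M (nestLv L M R' k) W₂ = φ → ScV (L ^ k) M (Rlev L M R' k) (projG (fine (L ^ k) M) (Rlev L M R' k) (LinearMap.ker (avgOp (L ^ k) M (taxiTv (L ^ k) M (Rlev L M R' k))))) W ≤ ScV (L ^ k) M (Rlev L M R' k) (projG (fine (L ^ k) M) (Rlev L M R' k) (LinearMap.ker (avgOp (L ^ k) M (taxiTv (L ^ k) M (Rlev L M R' k))))) W₂) →
      rhoV (L ^ k) M (Rlev L M R' k) W ≤ (8 * (4 * lamV d (((d - 1 : ℕ) : ℝ) * c) (d : ℝ) 0) + 2 * d * c * ((2 * (1 + CDs)) + (2 * (CDs' + (d : ℝ) * c * 64))) + (8 * (4 * d * 36 ^ d * (1 + ((d - 1 : ℕ) : ℝ) * c) ^ 2) ^ 2 + 5 * (d : ℝ) ^ 2 * c ^ 2) * (max (40 * (2 * (1 + CDs))) (64 + 40 * (2 * (CDs' + (d : ℝ) * c * 64))))) * (ScV (L ^ k) M (Rlev L M R' k) (projG (fine (L ^ k) M)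 (Rlev L M R' k) (LinearMap.ker (avgOp (L ^ k) M (taxiTv (L ^ k) M (Rlev L M R' k))))) W + nsqV M φ)) := by
  have hR' : ∀ k x μ, ‖R' k x μ‖ ≤ 1 := fun k x μ => norm_le_one_of_mem_unitary (hU k x μ)
  have hPG0 : ∀ k W, 0 ≤ (projG (fine (L ^ k) M) (Rlev L M R' k) (LinearMap.ker (avgOp (L ^ k) M (taxiTv (L ^ k) M (Rlev L M R' k))))) W := fun k W => projG_nonneg _ _ _ W
  have hSc0 : ∀ k W, 0 ≤ ScV (L ^ k) M (Rlev L M R' k) (projG (fine (L ^ k) M) (Rlev L M R' k) (LinearMap.ker (avgOp (L ^ k) M (taxiTv (L ^ k) M (Rlev L M R' k))))) W := fun k W => ScV_nonneg (L ^ k) M _ (hPG0 k) W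
  have hcUB : ∀ k, (kappaV d (L ^ k))⁻¹ * ((∑ q ∈ Finset.range k, ((((d - 1 : ℕ) : ℝ) + (d : ℝ) * d) * (((L : ℝ) * ((L ^ q - 1 : ℕ) : ℝ) * ((L - 1 : ℕ) : ℝ)) * b q)))
      + 3 * (((d - 1 : ℕ) : ℝ) * (L ^ k : ℕ) * ((L ^ k - 1 : ℕ) : ℝ) * a k)) < 1 := fun k => lt_of_le_of_lt (hκγ k) (by norm_num)
  have hsmallp : ∀ k, 80 * ((d : ℝ) * ((((L ^ k : ℕ) : ℝ)) ^ 2 * a k)) ≤ 1 := fun k => by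
    nlinarith [mul_le_mul_of_nonneg_left (hac k) (Nat.cast_nonneg (α := ℝ) d)]
  have hsmall80 : ∀ k, 2 * 40 * ((d : ℝ) * ((((L ^ k : ℕ) : ℝ)) ^ 2 * a k)) ≤ 1 := fun k => by linarith [hsmallp k]
  have hda : ∀ k, (d : ℝ) * ((((L ^ k : ℕ) : ℝ)) ^ 2 * a k) ≤ d * c := fun k => mul_le_mul_of_nonneg_left (hac k) (Nat.cast_nonneg d)
  have hda0 : ∀ k, 0 ≤ (d : ℝ) * ((((L ^ k : ℕ) : ℝ)) ^ 2 * a k) := fun k => by have := ha0 k; positivity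
  have hc0 : 0 ≤ c := le_trans (by have := ha0 0; positivity) (hac 0)
  -- uniform constants: V-UB, (Går), V-P, the reverse-Poincaré constant, V-REG
  set Λs : ℝ := 4 * lamV d (((d - 1 : ℕ) : ℝ) * c) (d : ℝ) 0 with hΛsdef
  set CGars : ℝ := 2 * (1 + CDs) with hCGarsdef
  set CGars' : ℝ := 2 * (CDs' + (d : ℝ) * c * 64) with hCGars'def
  set CPs : ℝ := max (40 * (2 * (1 + CDs))) (64 + 40 * (2 * (CDs' + (d : ℝ) * c * 64))) with hCPsdef
  set RPs : ℝ := 4 * d * 36 ^ d * (1 + ((d - 1 : ℕ) : ℝ) * c) ^ 2 with hRPsdef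
  set CRs : ℝ := 8 * Λs + 2 * d * c * (CGars + CGars') + (8 * RPs ^ 2 + 5 * (d : ℝ) ^ 2 * c ^ 2) * CPs with hCRsdef
  have hΛk0 : ∀ k, 0 ≤ lamV d ((L ^ k : ℕ) * (((d - 1 : ℕ) : ℝ) * ((L ^ k - 1 : ℕ) : ℝ) * a k)) d (((L ^ k : ℕ) : ℝ) ^ 2 * 0)
      / (1 - (kappaV d (L ^ k))⁻¹ * ((∑ q ∈ Finset.range k, ((((d - 1 : ℕ) : ℝ) + (d : ℝ) * d) * (((L : ℝ) * ((L ^ q - 1 : ℕ) : ℝ) * ((L - 1 : ℕ) : ℝ)) * b q)))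
          + 3 * (((d - 1 : ℕ) : ℝ) * (L ^ k : ℕ) * ((L ^ k - 1 : ℕ) : ℝ) * a k))) ^ 2 :=
    fun k => div_nonneg (lamV_nonneg (Nat.cast_nonneg d) (by positivity)) (sq_nonneg _)
  have hΛs0 : 0 ≤ Λs := (hΛk0 0).trans (hΛk 0)
  have hCGark : ∀ k : ℕ, 2 * (1 + CDs) ≤ CGars := fun k => le_of_eq hCGarsdef.symm
  have hCGark' : ∀ k, 2 * (CDs' + d * ((((L ^ k : ℕ) : ℝ)) ^ 2 * a k) * 64) ≤ CGars' := fun k => by rw [hCGars'def]; nlinarith [le_refl CDs', hda k]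
  have hCGar0 : ∀ k : ℕ, 0 ≤ 2 * (1 + CDs) := fun k => by have := hCDs0; positivity
  have hCGar0' : ∀ k, 0 ≤ 2 * (CDs' + d * ((((L ^ k : ℕ) : ℝ)) ^ 2 * a k) * 64) := fun k => by have := hCDs0'; have := hda0 k; positivity
  have hCPk : ∀ k, max (40 * (2 * (1 + CDs))) (64 + 40 * (2 * (CDs' + d * ((((L ^ k : ℕ) : ℝ)) ^ 2 * a k) * 64))) ≤ CPs :=
    fun k => max_le_max (by linarith [hCGark k]) (by linarith [hCGark' k])
  have hCPk0 : ∀ k, 0 ≤ max (40 * (2 * (1 + CDs))) (64 + 40 * (2 * (CDs' + d * ((((L ^ k : ℕ) : ℝ)) ^ 2 * a k) * 64))) :=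
    fun k => le_max_of_le_left (by have := hCDs0; positivity)
  have hCPs0 : 0 ≤ CPs := (hCPk0 0).trans (hCPk 0)
  have hRPk : ∀ k, revPC d (L ^ k) (((d - 1 : ℕ) : ℝ) * ((L ^ k - 1 : ℕ) : ℝ) * a k) ≤ RPs := fun k => by
    have h := blockDefect_le_of_class (d := d) L k (ha0 k) (hac k)
    have h0 : 0 ≤ ((L ^ k : ℕ) : ℝ) * (((d - 1 : ℕ) : ℝ) * ((L ^ k - 1 : ℕ) : ℝ) * a k) := by have := ha0 k; positivity
    unfold revPC
    rw [hRPsdef]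
    have h1 : (1 + ((L ^ k : ℕ) : ℝ) * (((d - 1 : ℕ) : ℝ) * ((L ^ k - 1 : ℕ) : ℝ) * a k)) ^ 2 ≤ (1 + ((d - 1 : ℕ) : ℝ) * c) ^ 2 :=
      pow_le_pow_left₀ (by positivity) (by linarith) 2
    exact mul_le_mul_of_nonneg_left h1 (by positivity)
  -- the sockets, weakened to the uniform constants
  have hUBc : ∀ k (φ : Tor M → Fin d → ℂ), ∃ W, QvL (L ^ k) M (nestLv L M R' k) W = φ ∧ ScV (L ^ k) M (Rlev L M R' k) (projG (fine (L ^ k) M) (Rlev L M R' k) (LinearMap.ker (avgOp (L ^ k) M (taxiTv (L ^ k) M (Rlev L M R' k))))) W ≤ Λs * nsqV M φ :=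
    fun k φ => by
    obtain ⟨W, hW, hS⟩ := hUBc_projG_nestLv L M hU hb hcoh hd k (ha0 k) (ha k) (hcUB k) (LinearMap.ker (avgOp (L ^ k) M (taxiTv (L ^ k) M (Rlev L M R' k)))) φ
    exact ⟨W, hW, hS.trans (mul_le_mul_of_nonneg_right (hΛk k) (nsqV_nonneg M φ))⟩
  have hGar : ∀ k W, ((((L ^ k : ℕ) : ℝ)) ^ d)⁻¹ * ((((L ^ k : ℕ) : ℝ)) ^ 2 * roughV (L ^ k) M (Rlev L M R' k) W)
      ≤ CGars * ScV (L ^ k) M (Rlev L M R' k) (projG (fine (L ^ k) M) (Rlev L M R' k) (LinearMap.ker (avgOp (L ^ k) M (taxiTv (L ^ k) M (Rlev L M R' k))))) W + CGars' * nsqV M (QvL (L ^ k) M (nestLv L M R' k) W) := fun k W => by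
    have h := hGar_projG_nestLv L M hU hb hcoh hM2 k (ha0 k) (ha k) (hsmallP k) (hγs k) (hsmall80 k) (LinearMap.ker (avgOp (L ^ k) M (taxiTv (L ^ k) M (Rlev L M R' k)))) (hGdiv k) W
    exact h.trans (add_le_add (mul_le_mul_of_nonneg_right (hCGark k) (hSc0 k W)) (mul_le_mul_of_nonneg_right (hCGark' k) (nsqV_nonneg M _)))
  have hPc : ∀ k W, qWV (L ^ k) M W ≤ CPs * (ScV (L ^ k) M (Rlev L M R' k) (projG (fine (L ^ k) M) (Rlev L M R' k) (LinearMap.ker (avgOp (L ^ k) M (taxiTv (L ^ k) M (Rlev L M R' k))))) W + nsqV M (QvL (L ^ k) M (nestLv L M R' k) W)) := fun k W => by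
    have h := hPc_projG_nestLv L M hU hb hcoh hM2 k (ha0 k) (ha k) (hsmallP k) (hγs k) (hsmall80 k) (LinearMap.ker (avgOp (L ^ k) M (taxiTv (L ^ k) M (Rlev L M R' k)))) (hGdiv k) W
    exact h.trans (mul_le_mul_of_nonneg_right (hCPk k) (add_nonneg (hSc0 k W) (nsqV_nonneg M _)))
  -- V-REG at every level (leaf-03-g6's `hREG_projG`; frames the straight level-`k` taxi)
  have hREG : ∀ k (φ : Tor M → Fin d → ℂ) W, QvL (L ^ k) M (nestLv L M R' k) W = φ →
      (∀ W₂, QvL (L ^ k) M (nestLv L M R' k) W₂ = φ → ScV (L ^ k) M (Rlev L M R' k) (projG (fine (L ^ k) M) (Rlev L M R' k) (LinearMap.ker (avgOp (L ^ k) M (taxiTv (L ^ k) M (Rlev L M R' k))))) W ≤ ScV (L ^ k) M (Rlev L M R' k) (projG (fine (L ^ k) M) (Rlev L M R' k) (LinearMap.ker (avgOp (L ^ k) M (taxiTv (L ^ k) M (Rlev L M R' k))))) W₂) →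
      rhoV (L ^ k) M (Rlev L M R' k) W ≤ CRs * (ScV (L ^ k) M (Rlev L M R' k) (projG (fine (L ^ k) M) (Rlev L M R' k) (LinearMap.ker (avgOp (L ^ k) M (taxiTv (L ^ k) M (Rlev L M R' k))))) W + nsqV M φ) := fun k φ W hW hmin => by
    have hUk : ∀ x μ, Rlev L M R' k x μ ∈ unitary (ℂ →L[ℂ] ℂ) := Rlev_mem_unitary L M hU k
    have hw := inBlock_blockOf_of_bpt (L ^ k) M hM2
      (P := fun x μ => ‖Rlev L M R' k x μ * star (taxiTv (L ^ k) M (Rlev L M R' k) (x + unitVec (fine (L ^ k) M) μ)) * taxiTv (L ^ k) M (Rlev L M R' k) x - 1‖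
        ≤ ((d - 1 : ℕ) : ℝ) * ((L ^ k - 1 : ℕ) : ℝ) * a k)
      (fun y j μ hj => inBlock_defect_taxiTv_adjoint_le (L ^ k) M hUk (ha k) y j μ hj)
    have hw0 : 0 ≤ ((d - 1 : ℕ) : ℝ) * ((L ^ k - 1 : ℕ) : ℝ) * a k := by have := ha0 k; positivity
    have h := hREG_projG (L ^ k) M hUk (ha0 k) (fun x μ ν => ha k x μ ν) (taxiTv_mem_unitary (L ^ k) M hUk) hw0 hw (norm_nestLv_le_one L M hR' k)
      (hΛk0 k) (hCGar0 k) (hCGar0' k) (hUBc_projG_nestLv L M hU hb hcoh hd k (ha0 k) (ha k) (hcUB k) (LinearMap.ker (avgOp (L ^ k) M (taxiTv (L ^ k) M (Rlev L M R' k)))))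
      (fun W => by simpa only [Nat.cast_pow] using hPc_projG_nestLv L M hU hb hcoh hM2 k (ha0 k) (ha k) (hsmallP k) (hγs k) (hsmall80 k) (LinearMap.ker (avgOp (L ^ k) M (taxiTv (L ^ k) M (Rlev L M R' k)))) (hGdiv k) W)
      (fun W => by simpa only [Nat.cast_pow] using hGar_projG_nestLv L M hU hb hcoh hM2 k (ha0 k) (ha k) (hsmallP k) (hγs k) (hsmall80 k) (LinearMap.ker (avgOp (L ^ k) M (taxiTv (L ^ k) M (Rlev L M R' k)))) (hGdiv k) W)
      φ W hW hmin
    have hS0' : 0 ≤ ScV (L ^ k) M (Rlev L M R' k) (projG (fine (L ^ k) M) (Rlev L M R' k) (LinearMap.ker (avgOp (L ^ k) M (taxiTv (L ^ k) M (Rlev L M R' k))))) W + nsqV M φ := add_nonneg (hSc0 k W) (nsqV_nonneg M φ)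
    -- `h` in this file's cast letters
    have h' : rhoV (L ^ k) M (Rlev L M R' k) W
        ≤ (8 * (lamV d ((L ^ k : ℕ) * (((d - 1 : ℕ) : ℝ) * ((L ^ k - 1 : ℕ) : ℝ) * a k)) d (((L ^ k : ℕ) : ℝ) ^ 2 * 0)
              / (1 - (kappaV d (L ^ k))⁻¹ * ((∑ q ∈ Finset.range k, ((((d - 1 : ℕ) : ℝ) + (d : ℝ) * d) * (((L : ℝ) * ((L ^ q - 1 : ℕ) : ℝ) * ((L - 1 : ℕ) : ℝ)) * b q)))
                + 3 * (((d - 1 : ℕ) : ℝ) * (L ^ k : ℕ) * ((L ^ k - 1 : ℕ) : ℝ) * a k))) ^ 2)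
            + 2 * d * ((((L ^ k : ℕ) : ℝ)) ^ 2 * a k) * (2 * (1 + CDs) + 2 * (CDs' + d * ((((L ^ k : ℕ) : ℝ)) ^ 2 * a k) * 64))
            + (8 * revPC d (L ^ k) (((d - 1 : ℕ) : ℝ) * ((L ^ k - 1 : ℕ) : ℝ) * a k) ^ 2 + 5 * (d : ℝ) ^ 2 * (((((L ^ k : ℕ) : ℝ)) ^ 2 * a k)) ^ 2)
              * max (40 * (2 * (1 + CDs))) (64 + 40 * (2 * (CDs' + d * ((((L ^ k : ℕ) : ℝ)) ^ 2 * a k) * 64))))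
          * (ScV (L ^ k) M (Rlev L M R' k) (projG (fine (L ^ k) M) (Rlev L M R' k) (LinearMap.ker (avgOp (L ^ k) M (taxiTv (L ^ k) M (Rlev L M R' k))))) W + nsqV M φ) := by
      simpa only [Nat.cast_pow] using h
    refine h'.trans (mul_le_mul_of_nonneg_right ?_ hS0')
    -- the level-`k` V-REG constant is below `CRs`
    have hRP := hRPk k
    have hRP0 : 0 ≤ revPC d (L ^ k) (((d - 1 : ℕ) : ℝ) * ((L ^ k - 1 : ℕ) : ℝ) * a k) := by unfold revPC; positivity
    have hG1 : 2 * (1 + CDs) + 2 * (CDs' + d * ((((L ^ k : ℕ) : ℝ)) ^ 2 * a k) * 64) ≤ CGars + CGars' := by linarith [hCGark k, hCGark' k]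
    have hG10 : 0 ≤ 2 * (1 + CDs) + 2 * (CDs' + d * ((((L ^ k : ℕ) : ℝ)) ^ 2 * a k) * 64) := add_nonneg (hCGar0 k) (hCGar0' k)
    have t1 : 8 * (lamV d ((L ^ k : ℕ) * (((d - 1 : ℕ) : ℝ) * ((L ^ k - 1 : ℕ) : ℝ) * a k)) d (((L ^ k : ℕ) : ℝ) ^ 2 * 0)
        / (1 - (kappaV d (L ^ k))⁻¹ * ((∑ q ∈ Finset.range k, ((((d - 1 : ℕ) : ℝ) + (d : ℝ) * d) * (((L : ℝ) * ((L ^ q - 1 : ℕ) : ℝ) * ((L - 1 : ℕ) : ℝ)) * b q)))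
            + 3 * (((d - 1 : ℕ) : ℝ) * (L ^ k : ℕ) * ((L ^ k - 1 : ℕ) : ℝ) * a k))) ^ 2) ≤ 8 * Λs := by linarith [hΛk k]
    have t2 : 2 * d * ((((L ^ k : ℕ) : ℝ)) ^ 2 * a k) * (2 * (1 + CDs) + 2 * (CDs' + d * ((((L ^ k : ℕ) : ℝ)) ^ 2 * a k) * 64))
        ≤ 2 * d * c * (CGars + CGars') := by
      have h1 : (d : ℝ) * ((((L ^ k : ℕ) : ℝ)) ^ 2 * a k) * (2 * (1 + CDs) + 2 * (CDs' + d * ((((L ^ k : ℕ) : ℝ)) ^ 2 * a k) * 64))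
          ≤ (d : ℝ) * c * (CGars + CGars') := mul_le_mul (hda k) hG1 hG10 (mul_nonneg (Nat.cast_nonneg d) hc0)
      calc 2 * (d : ℝ) * ((((L ^ k : ℕ) : ℝ)) ^ 2 * a k) * (2 * (1 + CDs) + 2 * (CDs' + d * ((((L ^ k : ℕ) : ℝ)) ^ 2 * a k) * 64))
          = 2 * ((d : ℝ) * ((((L ^ k : ℕ) : ℝ)) ^ 2 * a k) * (2 * (1 + CDs) + 2 * (CDs' + d * ((((L ^ k : ℕ) : ℝ)) ^ 2 * a k) * 64))) := by ring
        _ ≤ 2 * ((d : ℝ) * c * (CGars + CGars')) := by linarith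
        _ = 2 * d * c * (CGars + CGars') := by ring
    have t3 : (8 * revPC d (L ^ k) (((d - 1 : ℕ) : ℝ) * ((L ^ k - 1 : ℕ) : ℝ) * a k) ^ 2 + 5 * (d : ℝ) ^ 2 * (((((L ^ k : ℕ) : ℝ)) ^ 2 * a k)) ^ 2)
        * max (40 * (2 * (1 + CDs))) (64 + 40 * (2 * (CDs' + d * ((((L ^ k : ℕ) : ℝ)) ^ 2 * a k) * 64)))
        ≤ (8 * RPs ^ 2 + 5 * (d : ℝ) ^ 2 * c ^ 2) * CPs := by
      have hq : (d : ℝ) ^ 2 * (((((L ^ k : ℕ) : ℝ)) ^ 2 * a k)) ^ 2 ≤ (d : ℝ) ^ 2 * c ^ 2 := by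
        have h2 : ((d : ℝ) * ((((L ^ k : ℕ) : ℝ)) ^ 2 * a k)) ^ 2 ≤ ((d : ℝ) * c) ^ 2 := pow_le_pow_left₀ (hda0 k) (hda k) 2
        calc (d : ℝ) ^ 2 * (((((L ^ k : ℕ) : ℝ)) ^ 2 * a k)) ^ 2 = ((d : ℝ) * ((((L ^ k : ℕ) : ℝ)) ^ 2 * a k)) ^ 2 := by ring
          _ ≤ ((d : ℝ) * c) ^ 2 := h2
          _ = (d : ℝ) ^ 2 * c ^ 2 := by ring
      have hr : revPC d (L ^ k) (((d - 1 : ℕ) : ℝ) * ((L ^ k - 1 : ℕ) : ℝ) * a k) ^ 2 ≤ RPs ^ 2 := pow_le_pow_left₀ hRP0 hRP 2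
      have hsum : 8 * revPC d (L ^ k) (((d - 1 : ℕ) : ℝ) * ((L ^ k - 1 : ℕ) : ℝ) * a k) ^ 2 + 5 * (d : ℝ) ^ 2 * (((((L ^ k : ℕ) : ℝ)) ^ 2 * a k)) ^ 2
          ≤ 8 * RPs ^ 2 + 5 * (d : ℝ) ^ 2 * c ^ 2 := by linarith
      exact mul_le_mul hsum (hCPk k) (hCPk0 k) (by positivity)
    rw [hCRsdef]
    linarith [t1, t2, t3]
  exact ⟨hUBc, hGar, hPc, hREG⟩

/-! ## §2 THE RATE END for Bałaban's covariant projected functional in the regular class -/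

/-- **THE VECTOR END WITH RATE AT BAŁABAN's TAXI DATA FOR BAŁABAN's COVARIANT PROJECTED GAUGE FUNCTIONAL ⇐ (SLICE-min) + (ONE-min) + A REGULAR PRESENTATION.**
Part 4's `towerLimitRate_effV_taxiTower_min_of_class` for `G k := projG (Rlev k) (ker Q_{taxiTv (Rlev k)})` with the whole G-side INHABITED (matrix form `GmProj`, pullback
`Gtr`, (GF1′) `C_G = d, C₀ = 0`, (Går) from part 7's (GF3)_k, V-REG from leaf-03-g6's `hREG_projG`); DISPLAYED: the data classes (one-step plaquette class, regular
presentation, numeric smallness) and the two analytic leaves (SLICE-min)_k, (ONE-min)_k with geometric costs. [folklore] -/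
theorem towerLimitRate_effV_taxiTower_projG_regular_of_class (hL : 2 ≤ L) (hd : 1 ≤ d) (hM2 : ∀ μ, 1 < M μ)
    -- the one-step bond data: unitary, plaquette class, coherent
    (hU : ∀ k x μ, R' k x μ ∈ unitary (ℂ →L[ℂ] ℂ)) {b : ℕ → ℝ} {c : ℝ}
    (hb : ∀ k x κ ι, ‖R' k x κ * R' k (x + unitVec (fine L (fine (L ^ k) M)) κ) ι - R' k x ι * R' k (x + unitVec (fine L (fine (L ^ k) M)) ι) κ‖ ≤ b k)
    (hbc : ∀ k, (((L ^ (k + 1) : ℕ)) : ℝ) ^ 2 * b k ≤ c)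
    (hcoh : ∀ k, coarseTv L (fine (L ^ (k + 1)) M) (R' (k + 1)) = Rtrv (L ^ k) L M (R' k))
    -- the polynomial smallness of the class constant
    (hsm1 : 60 * (6 : ℝ) ^ (d - 1) * ((2 * ((((d - 1 : ℕ) : ℝ) + (d : ℝ) * d)) + 3 * ((d - 1 : ℕ) : ℝ)) * c) ≤ 1 / 2)
    (hsm2 : 2 * (d : ℝ) * ((((d - 1 : ℕ) : ℝ)) * c) ^ 2 ≤ 1 / 2) (hsm3 : 64 * (2 * ((((d - 1 : ℕ) : ℝ) + (d : ℝ) * d) * c)) ^ 2 ≤ 1)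
    (hsm4 : 80 * ((d : ℝ) * c) ≤ 1)
    -- the DISPLAYED regular presentation of the tower's unit-lattice bond fields and the numeric smallness replacing (GF3)
    {ar ℓr : ℕ → ℝ} {α lam : ℝ} (har0 : ∀ k, 0 ≤ ar k) (har : ∀ k x μ, ‖Rlev L M R' k x μ - 1‖ ≤ ar k)
    (hℓr : ∀ k x μ, ‖Rlev L M R' k x μ - Rlev L M R' k (x - unitVec (fine (L ^ k) M) μ) μ‖ ≤ ℓr k)
    (hα : ∀ k, (((L ^ k : ℕ)) : ℝ) * ar k ≤ α) (hlam : ∀ k, (((L ^ k : ℕ)) : ℝ) ^ 2 * ℓr k ≤ lam)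
    (hsmallδ : (18 * (d * ((d + 1 : ℝ) * Cst d 1)) + 6) * deltaGap d 1 α lam (d * α) (((d - 1 : ℕ) : ℝ) * c) ^ 2 ≤ 1 / 2)
    (hsmallQ : ((d + 1 : ℝ) * Cst d 1) * (7 * (d * α ^ 2) + 2 * (2 * ((((d - 1 : ℕ) : ℝ) + (d : ℝ) * d) * c) + (d * α + α)) ^ 2) ≤ 1 / 2)
    -- the gauge SLICE with decaying costs (DISPLAYED leaf (SLICE-min))
    (σ σ' : ℕ → ℝ) {cσ cσ' : ℝ} (hσ : ∀ k, 0 ≤ σ k) (hσ' : ∀ k, 0 ≤ σ' k)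
    (hsliceMin : ∀ k (φ : Tor M → Fin d → ℂ) (g₀ : Tor (fine L (fine (L ^ k) M)) → Fin d → ℂ),
      QvL (L ^ k) M (nestLv L M R' k) (QvL L (fine (L ^ k) M) (lineT L (fine (L ^ k) M) (taxiTv L (fine (L ^ k) M) (R' k)) (R' k)) g₀) = φ →
      (∀ W', QvL (L ^ k) M (nestLv L M R' k) (QvL L (fine (L ^ k) M) (lineT L (fine (L ^ k) M) (taxiTv L (fine (L ^ k) M) (R' k)) (R' k)) W') = φ →
        SfV (L ^ k) L M (R' k) (fun W' => (projG (fine (L ^ (k + 1)) M) (Rlev L M R' (k + 1)) (LinearMap.ker (avgOp (L ^ (k + 1)) M (taxiTv (L ^ (k + 1)) M (Rlev L M R' (k + 1)))))) (W' ∘ Literature.MathematicalPhysics.QuantumFieldTheory.Balaban1983to89.B5Composition116.sites (L ^ k) L M)) g₀ ≤ SfV (L ^ k) L M (R' k) (fun W' => (projG (fine (L ^ (k + 1)) M) (Rlev L M R' (k + 1)) (LinearMap.ker (avgOp (L ^ (k + 1)) M (taxiTv (L ^ (k + 1)) M (Rlev L M R' (k + 1)))))) (W' ∘ Literature.MathematicalPhysics.QuantumFieldTheory.Balaban1983to89.B5Composition116.sites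 (L ^ k) L M)) W') →
      ∃ Ws, QvL (L ^ k) M (nestLv L M R' k) Ws = φ ∧
        ScV (L ^ k) M (Rlev L M R' k) (projG (fine (L ^ k) M) (Rlev L M R' k) (LinearMap.ker (avgOp (L ^ k) M (taxiTv (L ^ k) M (Rlev L M R' k))))) Ws
          ≤ ScV (L ^ k) M (Rlev L M R' k) (fun _ => 0) (QvL L (fine (L ^ k) M) (lineT L (fine (L ^ k) M) (taxiTv L (fine (L ^ k) M) (R' k)) (R' k)) g₀)
            + σ' k * ScV (L ^ k) M (Rlev L M R' k) (fun _ => 0) (QvL L (fine (L ^ k) M) (lineT L (fine (L ^ k) M) (taxiTv L (fine (L ^ k) M) (R' k)) (R' k)) g₀)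
            + σ k * qWV (L ^ k) M (QvL L (fine (L ^ k) M) (lineT L (fine (L ^ k) M) (taxiTv L (fine (L ^ k) M) (R' k)) (R' k)) g₀))
    -- the rate and the decay of the slice costs
    {aa : ℝ} (haa : 0 < aa) {θ : ℝ} (hθL : (L : ℝ)⁻¹ ≤ θ) (hθ1 : θ < 1) (hσθ : ∀ k, σ k ≤ cσ * θ ^ k) (hσ'θ : ∀ k, σ' k ≤ cσ' * θ ^ k)
    -- leaf V-ONE for the FULL fine form (DISPLAYED leaf (ONE-min)), V-REG size `rhoV`
    (ε₁ δ' : ℕ → ℝ) {cε cδ' : ℝ} (hε₁ : ∀ k, 0 ≤ ε₁ k) (hδ' : ∀ k, 0 ≤ δ' k)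
    (hεθ : ∀ k, ε₁ k ≤ cε * θ ^ k) (hδ'θ : ∀ k, δ' k ≤ cδ' * θ ^ k)
    (hONEm : ∀ k (φ : Tor M → Fin d → ℂ) (W₀ : Tor (fine (L ^ k) M) → Fin d → ℂ), QvL (L ^ k) M (nestLv L M R' k) W₀ = φ →
      (∀ W, QvL (L ^ k) M (nestLv L M R' k) W = φ → ScV (L ^ k) M (Rlev L M R' k) (projG (fine (L ^ k) M) (Rlev L M R' k) (LinearMap.ker (avgOp (L ^ k) M (taxiTv (L ^ k) M (Rlev L M R' k))))) W₀ ≤ ScV (L ^ k) M (Rlev L M R' k) (projG (fine (L ^ k) M) (Rlev L M R' k) (LinearMap.ker (avgOp (L ^ k) M (taxiTv (L ^ k) M (Rlev L M R' k))))) W) →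
      ∃ g, QvL (L ^ k) M (nestLv L M R' k) (QvL L (fine (L ^ k) M) (lineT L (fine (L ^ k) M) (taxiTv L (fine (L ^ k) M) (R' k)) (R' k)) g) = φ ∧
        SfV (L ^ k) L M (R' k) (fun W' => (projG (fine (L ^ (k + 1)) M) (Rlev L M R' (k + 1)) (LinearMap.ker (avgOp (L ^ (k + 1)) M (taxiTv (L ^ (k + 1)) M (Rlev L M R' (k + 1)))))) (W' ∘ Literature.MathematicalPhysics.QuantumFieldTheory.Balaban1983to89.B5Composition116.sites (L ^ k) L M)) g ≤ (Real.sqrt (ScV (L ^ k) M (Rlev L M R' k) (projG (fine (L ^ k) M) (Rlev L M R' k) (LinearMap.ker (avgOp (L ^ k) M (taxiTv (L ^ k) M (Rlev L M R' k))))) W₀ + ε₁ k * rhoV (L ^ k) M (Rlev L M R' k) W₀) + δ' k * Real.sqrt (qWV (L ^ k) M W₀)) ^ 2) :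
    TowerLimitRate (ι := fun _ => Tor M × Fin d) (fun _ => (1 : Matrix (Tor M × Fin d) (Tor M × Fin d) ℂ)) 1
      (fun k => effV (L ^ k) M (Rlev L M R' k)
        (GmProj (fine (L ^ k) M) (Rlev L M R' k) (LinearMap.ker (avgOp (L ^ k) M (taxiTv (L ^ k) M (Rlev L M R' k))))) (QmL (L ^ k) M (nestLv L M R' k)) aa)
      (eV (4 * lamV d (((d - 1 : ℕ) : ℝ) * c) (d : ℝ) 0) (max (40 * (2 * (1 + (36 * (d * ((d + 1 : ℝ) * Cst d 1)) + 8)))) (64 + 40 * (2 * ((24 * (d * ((d + 1 : ℝ) * Cst d 1)) + 4) + (d : ℝ) * c * 64)))) (2 * d * ((d : ℝ) * c + L * c))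
        + cσ' * ((4 * lamV d (((d - 1 : ℕ) : ℝ) * c) (d : ℝ) 0) + eV (4 * lamV d (((d - 1 : ℕ) : ℝ) * c) (d : ℝ) 0) (max (40 * (2 * (1 + (36 * (d * ((d + 1 : ℝ) * Cst d 1)) + 8)))) (64 + 40 * (2 * ((24 * (d * ((d + 1 : ℝ) * Cst d 1)) + 4) + (d : ℝ) * c * 64)))) (2 * d * ((d : ℝ) * c + L * c)))
        + cσ * ((max (40 * (2 * (1 + (36 * (d * ((d + 1 : ℝ) * Cst d 1)) + 8)))) (64 + 40 * (2 * ((24 * (d * ((d + 1 : ℝ) * Cst d 1)) + 4) + (d : ℝ) * c * 64)))) * ((4 * lamV d (((d - 1 : ℕ) : ℝ) * c) (d : ℝ) 0) + 1))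
        + ePV (4 * lamV d (((d - 1 : ℕ) : ℝ) * c) (d : ℝ) 0) (max (40 * (2 * (1 + (36 * (d * ((d + 1 : ℝ) * Cst d 1)) + 8)))) (64 + 40 * (2 * ((24 * (d * ((d + 1 : ℝ) * Cst d 1)) + 4) + (d : ℝ) * c * 64))))
            (8 * (4 * lamV d (((d - 1 : ℕ) : ℝ) * c) (d : ℝ) 0) + 2 * d * c * ((2 * (1 + (36 * (d * ((d + 1 : ℝ) * Cst d 1)) + 8))) + (2 * ((24 * (d * ((d + 1 : ℝ) * Cst d 1)) + 4) + (d : ℝ) * c * 64))) + (8 * (4 * d * 36 ^ d * (1 + ((d - 1 : ℕ) : ℝ) * c) ^ 2) ^ 2 + 5 * (d : ℝ) ^ 2 * c ^ 2) * (max (40 * (2 * (1 + (36 * (d * ((d + 1 : ℝ) * Cst d 1)) + 8)))) (64 + 40 * (2 * ((24 * (d * ((d + 1 : ℝ) * Cst d 1)) + 4) + (d : ℝ) * c * 64))))) cε cδ') θ := by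
  have hθ : 0 ≤ θ := le_trans (by positivity) hθL
  have hCst := Literature.MathematicalPhysics.QuantumFieldTheory.Balaban1983to89.B5Prop11Lower.one_le_Cst (d := d) (1 : ℝ)
  have hCDs0 : (0 : ℝ) ≤ (36 * (d * ((d + 1 : ℝ) * Cst d 1)) + 8) := by positivity
  have hCDs0' : (0 : ℝ) ≤ (24 * (d * ((d + 1 : ℝ) * Cst d 1)) + 4) := by positivity
  -- the class package (plaquette bounds of `Rlev k`, the smallness lines, `Λ_k ≤ Λ⋆`) with the (GF1′) constants of `projG`: `C_G = d`, `C₀ = 0`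
  obtain ⟨a, ha0, ha, hac, hκγ, hsmallP, hγs, -, hΛk⟩ := taxiClassPackage L M hL hd hU hb hbc hsm1 hsm2 hsm3 (CG := fun _ => (d : ℝ)) (C₀ := fun _ => 0)
    (CGs := (d : ℝ)) (c₀ := 0) (fun _ => Nat.cast_nonneg d) (fun _ => le_rfl) (fun _ => le_rfl) (fun _ => by simp)
  -- (GF3) at every level, SUPPLIED by part 7
  have hGdiv : ∀ k W, ((((L ^ k : ℕ) : ℝ)) ^ d)⁻¹ * ((((L ^ k : ℕ) : ℝ)) ^ 2 * divSq (fine (L ^ k) M) (Rlev L M R' k) W)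
      ≤ (36 * (d * ((d + 1 : ℝ) * Cst d 1)) + 8) * ScV (L ^ k) M (Rlev L M R' k) (projG (fine (L ^ k) M) (Rlev L M R' k) (LinearMap.ker (avgOp (L ^ k) M (taxiTv (L ^ k) M (Rlev L M R' k))))) W
        + (24 * (d * ((d + 1 : ℝ) * Cst d 1)) + 4) * nsqV M (QvL (L ^ k) M (nestLv L M R' k) W) := fun k W =>
    hGdiv_projG_nestLv_regular L M hL hU hb hbc hcoh hd hM2 k (ha0 k) (ha k) (hac k) (har0 k) (har k) (hℓr k) (hα k) (hlam k) hsmallδ hsmallQ W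
  obtain ⟨-, hGar, -, hREG⟩ := projG_sockets_nestLv L M hd hM2 hU hb hcoh ha0 ha hac hκγ hsmallP hγs hΛk hsm4 hCDs0 hCDs0' hGdiv
  have hc0 : 0 ≤ c := le_trans (by have := ha0 0; positivity) (hac 0)
  have hκ0' : ∀ k : ℕ, 0 ≤ 2 * ((24 * (d * ((d + 1 : ℝ) * Cst d 1)) + 4) + (d : ℝ) * c * 64) := fun _ => by positivity
  have hCRs0 : 0 ≤ (8 * (4 * lamV d (((d - 1 : ℕ) : ℝ) * c) (d : ℝ) 0) + 2 * d * c * ((2 * (1 + (36 * (d * ((d + 1 : ℝ) * Cst d 1)) + 8))) + (2 * ((24 * (d * ((d + 1 : ℝ) * Cst d 1)) + 4) + (d : ℝ) * c * 64)))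
      + (8 * (4 * d * 36 ^ d * (1 + ((d - 1 : ℕ) : ℝ) * c) ^ 2) ^ 2 + 5 * (d : ℝ) ^ 2 * c ^ 2)
        * (max (40 * (2 * (1 + (36 * (d * ((d + 1 : ℝ) * Cst d 1)) + 8)))) (64 + 40 * (2 * ((24 * (d * ((d + 1 : ℝ) * Cst d 1)) + 4) + (d : ℝ) * c * 64))))) := by
    have hΛ : 0 ≤ lamV d (((d - 1 : ℕ) : ℝ) * c) (d : ℝ) 0 := lamV_nonneg (Nat.cast_nonneg d) (by positivity)
    have hmax : 0 ≤ max (40 * (2 * (1 + (36 * (d * ((d + 1 : ℝ) * Cst d 1)) + 8)))) (64 + 40 * (2 * ((24 * (d * ((d + 1 : ℝ) * Cst d 1)) + 4) + (d : ℝ) * c * 64))) := le_max_of_le_left (by positivity)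
    positivity
  exact towerLimitRate_effV_taxiTower_min_of_class L M hL hd hM2 hU hb hbc hcoh hsm1 hsm2 hsm3
    (Gm := fun k => GmProj (fine (L ^ k) M) (Rlev L M R' k) (LinearMap.ker (avgOp (L ^ k) M (taxiTv (L ^ k) M (Rlev L M R' k)))))
    (G := fun k => (projG (fine (L ^ k) M) (Rlev L M R' k) (LinearMap.ker (avgOp (L ^ k) M (taxiTv (L ^ k) M (Rlev L M R' k))))))
    (G' := fun k => fun W' => (projG (fine (L ^ (k + 1)) M) (Rlev L M R' (k + 1)) (LinearMap.ker (avgOp (L ^ (k + 1)) M (taxiTv (L ^ (k + 1)) M (Rlev L M R' (k + 1)))))) (W' ∘ Literature.MathematicalPhysics.QuantumFieldTheory.Balaban1983to89.B5Composition116.sites (L ^ k) L M))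
    (fun k => GmProj_posSemidef _ _ _) (fun k W => projG_eq_qform _ _ _ W)
    (fun k => (Gtr_pullback (L ^ k) L M ((projG (fine (L ^ (k + 1)) M) (Rlev L M R' (k + 1)) (LinearMap.ker (avgOp (L ^ (k + 1)) M (taxiTv (L ^ (k + 1)) M (Rlev L M R' (k + 1)))))))).symm)
    (CG := fun _ => (d : ℝ)) (C₀ := fun _ => 0) (CGs := (d : ℝ)) (c₀ := 0) (κg := fun _ => 2 * (1 + (36 * (d * ((d + 1 : ℝ) * Cst d 1)) + 8)))
    (κs := 2 * (1 + (36 * (d * ((d + 1 : ℝ) * Cst d 1)) + 8))) (κs' := 2 * ((24 * (d * ((d + 1 : ℝ) * Cst d 1)) + 4) + (d : ℝ) * c * 64))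
    (κg' := fun _ => 2 * ((24 * (d * ((d + 1 : ℝ) * Cst d 1)) + 4) + (d : ℝ) * c * 64))
    (fun _ => Nat.cast_nonneg d) (fun _ => le_rfl) (fun _ => le_rfl) (fun _ => by simp) hκ0' (fun _ => le_rfl) (fun _ => le_rfl)
    (fun k W => hGF_projG_taxi L M hU k _ W) hGar
    σ σ' hσ hσ' hsliceMin haa hθL hθ1 hσθ hσ'θ (fun _ => _) ε₁ δ' (fun _ => hCRs0) (fun _ => le_rfl) hε₁ hδ' hεθ hδ'θ
    (fun k W => rhoV_nonneg (L ^ k) M _ W) hONEm hREG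

end Summit.QuantumFields.BalabanUV.T4Continuum.VariationalColourTaxiTransport

end
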